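import Literature.Analysis.FluidPDE.FourierL2PicardTransfer
import HarnessLib

/-!
# The Picard iteration in the weighted-`L²` class: uniform `X¹`/`X²` bounds under Tao's
# smallness condition

Tenth file of the weighted-`L²` Fourier-side construction of the local smooth solution of the
Navier–Stokes system with `H¹`-controlled lifespan (discharge of
`Literature.Analysis.FluidPDE.tao2011_fourier_local_existence`; Tao 2013, Thm. 5.4 (ii)+(iv)).
This is the quantitative heart of Tao's local existence theorem (proof of Thm. 5.1 = arXiv
Thm. 28, p. 16: "the nonlinear map `u ↦ Φ(u)` … is a contraction on the ball
`{‖u‖_{X¹} ≤ Cδ}` if `δ⁴T ≤ c`"), on the Fourier side and in the *homogeneous* norms: for the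
Picard iterates `v_n = picardIter c T a n` of a Sobolev-class datum `a` with

  `α₁ = ∫⁻ (‖η‖ ∑ⱼ‖a η j‖ₑ)²`  (`= (2π)⁻² ‖∇u₀‖²_{L²}`-type),  `α₂ = ∫⁻ (‖η‖² ∑ⱼ‖a η j‖ₑ)²`,

and the majorants `V_n(s, η) = ∑ⱼ ‖v_n s η j‖ₑ`, the four quantities

  `sup_{s∈[0,T]} ∫⁻(‖η‖V_n(s))²`,  `∫₀ᵀ∫⁻(‖η‖²V_n(s))²`,  `sup ∫⁻(‖η‖²V_n)²`,  `∫₀ᵀ∫⁻(‖η‖³V_n)²`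

stay bounded by `4α₁`, `(2/c)α₁`, `4α₂`, `(2/c)α₂` for **all `n`**, provided the smallness
condition `κ α₁ ≤ 1` holds with `κ = 2304 c⁻¹ C_N² K₃² (2T/c)^{1/2}` — i.e.
`T α₁² ≤ c³/(2 · 2304² C_N⁴K₃⁴)`, Tao's `‖u₀‖⁴_{Ḣ¹} T ≤ c₀ ν³` (`picard_uniform_bounds`). The
recursion combines `FourierL2DuhamelIntegrated` (`I₁ ≲ A^{3/2}(TP)^{1/2}`, `I₂ ≲ AB^{1/2}(TE)^{1/2}`)
with `FourierL2PicardTransfer`.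

## Wide class (forced twin)

Every theorem of this file taking `hEc : Continuous (uncurry E)` has a primed twin taking instead
`(hEm : Measurable (uncurry E)) (hEt : ∀ η, Continuous fun s => E s η)` — joint measurability and
continuity in time at each frequency, which is all the proofs use of the joint continuity (slice
and joint measurability, dominated convergence in time). This is the class of `E = D - F`, `D`
jointly continuous, `F = ∫₀ᵗ heat(t-s) • b(s) ds` a forcing term whose Leray-projected coefficient
`b` is discontinuous at `ξ = 0` (forced twin `ForcedFourier*`; Tao 2013, Thm. 5.4 is stated and
proved WITH the force). The unprimed theorems are their specialisations.

## References

* T. Tao, Anal. PDE 6 (2013) = arXiv:1108.1165, proof of Thm. 5.1/5.4 (arXiv pp. 16, 18),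
  Lemma 2.1 = arXiv Lemma 23. [Tao2011]
-/

noncomputable section

open MeasureTheory Real Set Filter Function intervalIntegral
open scoped ENNReal NNReal
open _root_.Topology

namespace Literature.Analysis.FluidPDE.FourierNS

/-! ### `ℝ≥0∞` power bookkeeping -/

/-- `(4x)^{1/2} = 2 x^{1/2}` in `ℝ≥0∞`. [folklore] -/
theorem four_mul_rpow_half (x : ℝ≥0∞) : (4 * x) ^ (1 / 2 : ℝ) = 2 * x ^ (1 / 2 : ℝ) := by
  rw [ENNReal.mul_rpow_of_nonneg _ _ (by norm_num)]
  congr 1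
  rw [show (4 : ℝ≥0∞) = 2 ^ (2 : ℕ) by norm_num, ← ENNReal.rpow_natCast, ← ENNReal.rpow_mul]
  norm_num

/-- `(4x)^{3/2} = 8 x^{3/2}` in `ℝ≥0∞`. [folklore] -/
theorem four_mul_rpow_three_halves (x : ℝ≥0∞) : (4 * x) ^ (3 / 2 : ℝ) = 8 * x ^ (3 / 2 : ℝ) := by
  rw [ENNReal.mul_rpow_of_nonneg _ _ (by norm_num)]
  congr 1
  rw [show (4 : ℝ≥0∞) = 2 ^ (2 : ℕ) by norm_num, ← ENNReal.rpow_natCast, ← ENNReal.rpow_mul,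
    show ((2 : ℕ) : ℝ) * (3 / 2) = ((3 : ℕ) : ℝ) by norm_num, ENNReal.rpow_natCast]
  norm_num

/-- `x^{3/2} x^{1/2} = x²` in `ℝ≥0∞`. [folklore] -/
theorem rpow_three_halves_mul_rpow_half (x : ℝ≥0∞) : x ^ (3 / 2 : ℝ) * x ^ (1 / 2 : ℝ) = x ^ 2 := by
  rw [← ENNReal.rpow_add_of_nonneg _ _ (by norm_num) (by norm_num), ← ENNReal.rpow_natCast]
  norm_num

/-- `x^{1/2} x^{1/2} = x` in `ℝ≥0∞` (private copy; the same one-liner is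
`energy_rpow_half_mul_self` of `EulerFourierGalerkinEnergy`, not imported here). [folklore] -/
private theorem rpow_half_mul_rpow_half (x : ℝ≥0∞) : x ^ (1 / 2 : ℝ) * x ^ (1 / 2 : ℝ) = x := by
  rw [← ENNReal.rpow_add_of_nonneg _ _ (by norm_num) (by norm_num)]
  norm_num


variable {c T : ℝ} {a : EuclideanSpace ℝ (Fin 3) → Fin 3 → ℂ}
  {E : ℝ → EuclideanSpace ℝ (Fin 3) → Fin 3 → ℂ}

/-! ### Component moments of a trajectory of the class -/

/-- Every component of `v = h - E` (`E` with decay of all orders) has finite weighted square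
moments of all orders. [folklore] -/
theorem lintegral_weight_hsub_apply_sq_lt_top (hc : 0 ≤ c) (ha : AEStronglyMeasurable a volume)
    (haw : ∀ (k : ℕ) j, ∫⁻ η, (ENNReal.ofReal ((1 + ‖η‖) ^ k) * ‖a η j‖ₑ) ^ 2 < ⊤)
    (hEd : ∀ K : ℕ, ∃ B : ℝ, ∀ t, HasDecay K B (E t)) (s : ℝ) (k : ℕ) (j : Fin 3) :
    ∫⁻ η, (ENNReal.ofReal ((1 + ‖η‖) ^ k) * ‖(heat c η (clamp T s) • a η - E s η) j‖ₑ) ^ 2 < ⊤ := by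
  obtain ⟨B, hB⟩ := hEd (k + (Module.finrank ℝ (EuclideanSpace ℝ (Fin 3)) + 1))
  refine lt_of_le_of_lt (lintegral_mono fun η => ?_)
    (lt_of_le_of_lt (lintegral_weight_majorant_hsub_sq_le c T a E hc ha s (hB s)) ?_)
  · exact pow_le_pow_left' (mul_le_mul' le_rfl (Finset.single_le_sum
      (f := fun j => ‖(heat c η (clamp T s) • a η - E s η) j‖ₑ) (fun _ _ => zero_le)
      (Finset.mem_univ j))) 2
  · refine ENNReal.add_lt_top.2 ⟨ENNReal.mul_lt_top (by simp)
      (lintegral_weight_majorant_sq_lt_top ha k (haw k)), ?_⟩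
    refine ENNReal.mul_lt_top (by simp) (ENNReal.mul_lt_top ?_
      (lintegral_weight_inv_sq_lt_top finrank_lt_two_mul_succ))
    exact ENNReal.pow_lt_top (ENNReal.mul_lt_top (by simp) ENNReal.ofReal_lt_top)

/-! ### The bilinear quantities `I₁`, `I₂` of a trajectory of the class -/

/-- **Level-one bilinear quantity of `v = h - E`.** If `∫⁻(‖η‖ M_v(s))² ≤ Ab` on `[0, T]` and
`∫₀ᵀ∫⁻(‖η‖² M_v(s))² ≤ Pb`, then
`I₁ = ∫ ‖ξ‖² ∫⁻_{(0,T]} φ_ξ² ≤ 4 C_N² K₃² Ab^{1/2} Ab (T Pb)^{1/2}` (`lintegral_sq_weight_Phi_le` with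
`p = q = v`). [cite: Tao2011, Lemma 2.1 (arXiv Lemma 23), (bilinear-2)]
Twin for the wide (jointly measurable, time-continuous at each frequency) class of `E`. -/
theorem lintegral_sq_weight_Phi_hsub_le' (hc : 0 < c) (ha : AEStronglyMeasurable a volume)
    (haw : ∀ (k : ℕ) j, ∫⁻ η, (ENNReal.ofReal ((1 + ‖η‖) ^ k) * ‖a η j‖ₑ) ^ 2 < ⊤)
    (hEm : Measurable (uncurry E)) (hEt : ∀ η, Continuous fun s => E s η)
    (hEd : ∀ K : ℕ, ∃ B : ℝ, ∀ t, HasDecay K B (E t))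
    {Ab Pb : ℝ≥0∞}
    (hA : ∀ s ∈ Icc 0 T, ∫⁻ η, (ENNReal.ofReal ‖η‖ *
      ∑ j, ‖(heat c η (clamp T s) • a η - E s η) j‖ₑ) ^ 2 ≤ Ab)
    (hP : ∫⁻ s in Ioc 0 T, ∫⁻ η, (ENNReal.ofReal (‖η‖ ^ 2) *
      ∑ j, ‖(heat c η (clamp T s) • a η - E s η) j‖ₑ) ^ 2 ≤ Pb) :
    ∫⁻ ξ, ENNReal.ofReal (‖ξ‖ ^ 2) * ∫⁻ s in Ioc 0 T, (ENNReal.ofReal (4 * π) *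
        (Fintype.card (Fin 3) : ℝ≥0∞) ^ 2 *
        ‖fconv (fun η => ((∑ j, ‖(heat c η (clamp T s) • a η - E s η) j‖ : ℝ) : ℂ))
          (fun η => ((∑ j, ‖(heat c η (clamp T s) • a η - E s η) j‖ : ℝ) : ℂ)) ξ‖ₑ) ^ 2 ≤
      4 * (ENNReal.ofReal (4 * π) * (Fintype.card (Fin 3) : ℝ≥0∞) ^ 2) ^ 2 *
        ((SNormLESNormFDerivOfEqConst ℂ (volume : Measure (EuclideanSpace ℝ (Fin 3))) 2 *
          ENNReal.ofReal (2 * π)) ^ (3 / 2 : ℝ)) ^ 2 *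
        (Ab ^ (1 / 2 : ℝ) * Ab * (ENNReal.ofReal T * Pb) ^ (1 / 2 : ℝ)) := by
  set v : ℝ → EuclideanSpace ℝ (Fin 3) → Fin 3 → ℂ := fun s η => heat c η (clamp T s) • a η - E s η with hv
  set m₀ := Module.finrank ℝ (EuclideanSpace ℝ (Fin 3)) + 1 with hm₀
  have hm₀lt : Module.finrank ℝ (EuclideanSpace ℝ (Fin 3)) < 2 * m₀ := finrank_lt_two_mul_succ
  have ha2 : ∀ j, ∫⁻ η, ‖a η j‖ₑ ^ 2 < ⊤ := fun j => by simpa using haw 0 j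
  obtain ⟨B₀, hB₀⟩ := hEd m₀
  have hvm : ∀ s, AEStronglyMeasurable (v s) volume := aestronglyMeasurable_hsub_slice' c T a E ha hEm
  have hvj : AEStronglyMeasurable (uncurry v) (volume.prod volume) :=
    aestronglyMeasurable_uncurry_hsub' c T a E ha hEm
  have hv2 : ∀ s j, MemLp (v s · j) 2 volume := memLp_hsub_apply' c T a E hc.le ha ha2 hEm hm₀lt hB₀
  have hvc : ∀ j s₀, Tendsto (fun s => eLpNorm ((v s · j) - (v s₀ · j)) 2 volume) (𝓝 s₀) (𝓝 0) :=
    tendsto_eLpNorm_hsub_apply' c T a E hc.le ha ha2 hEm hEt hm₀lt hB₀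
  have hvw : ∀ s (k : ℕ) j, ∫⁻ η, (ENNReal.ofReal ((1 + ‖η‖) ^ k) * ‖v s η j‖ₑ) ^ 2 < ⊤ :=
    fun s k j => lintegral_weight_hsub_apply_sq_lt_top hc.le ha haw hEd s k j
  have hsqe : ∀ Θ : EuclideanSpace ℝ (Fin 3) → ℝ≥0∞, eLpNorm Θ 2 volume ^ 2 = ∫⁻ η, Θ η ^ 2 := by
    intro Θ; rw [← lintegral_enorm_sq_eq_eLpNorm_sq]; simp only [enorm_eq_self]
  have hA' : ∀ s ∈ Icc 0 T, eLpNorm (fun η : EuclideanSpace ℝ (Fin 3) =>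
      ENNReal.ofReal ‖η‖ * ∑ j, ‖v s η j‖ₑ) 2 volume ^ 2 ≤ Ab := fun s hs => by
    rw [hsqe]; exact hA s hs
  have hP' : ∫⁻ s in Ioc 0 T, eLpNorm (fun η : EuclideanSpace ℝ (Fin 3) =>
      ENNReal.ofReal (‖η‖ ^ 2) * ∑ j, ‖v s η j‖ₑ) 2 volume ^ 2 ≤ Pb := by
    refine le_trans (le_of_eq (lintegral_congr fun s => hsqe _)) hP
  have h := lintegral_sq_weight_Phi_le hvm hvm hvj hvj hv2 hv2 hvc hvc hvw hvw hA' hA' hP' hP'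
  refine h.trans (le_of_eq ?_)
  ring

/-- **Level-one bilinear quantity of `v = h - E`.** If `∫⁻(‖η‖ M_v(s))² ≤ Ab` on `[0, T]` and
`∫₀ᵀ∫⁻(‖η‖² M_v(s))² ≤ Pb`, then
`I₁ = ∫ ‖ξ‖² ∫⁻_{(0,T]} φ_ξ² ≤ 4 C_N² K₃² Ab^{1/2} Ab (T Pb)^{1/2}` (`lintegral_sq_weight_Phi_le` with
`p = q = v`). [cite: Tao2011, Lemma 2.1 (arXiv Lemma 23), (bilinear-2)] -/
theorem lintegral_sq_weight_Phi_hsub_le (hc : 0 < c) (ha : AEStronglyMeasurable a volume)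
    (haw : ∀ (k : ℕ) j, ∫⁻ η, (ENNReal.ofReal ((1 + ‖η‖) ^ k) * ‖a η j‖ₑ) ^ 2 < ⊤)
    (hEc : Continuous (uncurry E)) (hEd : ∀ K : ℕ, ∃ B : ℝ, ∀ t, HasDecay K B (E t))
    {Ab Pb : ℝ≥0∞}
    (hA : ∀ s ∈ Icc 0 T, ∫⁻ η, (ENNReal.ofReal ‖η‖ *
      ∑ j, ‖(heat c η (clamp T s) • a η - E s η) j‖ₑ) ^ 2 ≤ Ab)
    (hP : ∫⁻ s in Ioc 0 T, ∫⁻ η, (ENNReal.ofReal (‖η‖ ^ 2) *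
      ∑ j, ‖(heat c η (clamp T s) • a η - E s η) j‖ₑ) ^ 2 ≤ Pb) :
    ∫⁻ ξ, ENNReal.ofReal (‖ξ‖ ^ 2) * ∫⁻ s in Ioc 0 T, (ENNReal.ofReal (4 * π) *
        (Fintype.card (Fin 3) : ℝ≥0∞) ^ 2 *
        ‖fconv (fun η => ((∑ j, ‖(heat c η (clamp T s) • a η - E s η) j‖ : ℝ) : ℂ))
          (fun η => ((∑ j, ‖(heat c η (clamp T s) • a η - E s η) j‖ : ℝ) : ℂ)) ξ‖ₑ) ^ 2 ≤
      4 * (ENNReal.ofReal (4 * π) * (Fintype.card (Fin 3) : ℝ≥0∞) ^ 2) ^ 2 *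
        ((SNormLESNormFDerivOfEqConst ℂ (volume : Measure (EuclideanSpace ℝ (Fin 3))) 2 *
          ENNReal.ofReal (2 * π)) ^ (3 / 2 : ℝ)) ^ 2 *
        (Ab ^ (1 / 2 : ℝ) * Ab * (ENNReal.ofReal T * Pb) ^ (1 / 2 : ℝ)) :=
  lintegral_sq_weight_Phi_hsub_le' hc ha haw hEc.measurable (fun η => hEc.uncurry_right η) hEd hA hP

/-- **Level-two bilinear quantity of `v = h - E`.** If moreover `∫⁻(‖η‖² M_v(s))² ≤ Bb` on
`[0, T]` and `∫₀ᵀ∫⁻(‖η‖³ M_v(s))² ≤ Eb`, then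
`I₂ = ∫ ‖ξ‖⁴ ∫⁻_{(0,T]} φ_ξ² ≤ 16 C_N² K₃² Bb^{1/2} Ab (T Eb)^{1/2}` (`lintegral_fourth_weight_Phi_le`
with `p = q = v`). [cite: Tao2011, Lemma 2.1 (arXiv Lemma 23)]
Twin for the wide (jointly measurable, time-continuous at each frequency) class of `E`. -/
theorem lintegral_fourth_weight_Phi_hsub_le' (hc : 0 < c) (ha : AEStronglyMeasurable a volume)
    (haw : ∀ (k : ℕ) j, ∫⁻ η, (ENNReal.ofReal ((1 + ‖η‖) ^ k) * ‖a η j‖ₑ) ^ 2 < ⊤)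
    (hEm : Measurable (uncurry E)) (hEt : ∀ η, Continuous fun s => E s η)
    (hEd : ∀ K : ℕ, ∃ B : ℝ, ∀ t, HasDecay K B (E t))
    {Ab Bb Eb : ℝ≥0∞}
    (hA : ∀ s ∈ Icc 0 T, ∫⁻ η, (ENNReal.ofReal ‖η‖ *
      ∑ j, ‖(heat c η (clamp T s) • a η - E s η) j‖ₑ) ^ 2 ≤ Ab)
    (hB : ∀ s ∈ Icc 0 T, ∫⁻ η, (ENNReal.ofReal (‖η‖ ^ 2) *
      ∑ j, ‖(heat c η (clamp T s) • a η - E s η) j‖ₑ) ^ 2 ≤ Bb)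
    (hE : ∫⁻ s in Ioc 0 T, ∫⁻ η, (ENNReal.ofReal (‖η‖ ^ 3) *
      ∑ j, ‖(heat c η (clamp T s) • a η - E s η) j‖ₑ) ^ 2 ≤ Eb) :
    ∫⁻ ξ, ENNReal.ofReal (‖ξ‖ ^ 4) * ∫⁻ s in Ioc 0 T, (ENNReal.ofReal (4 * π) *
        (Fintype.card (Fin 3) : ℝ≥0∞) ^ 2 *
        ‖fconv (fun η => ((∑ j, ‖(heat c η (clamp T s) • a η - E s η) j‖ : ℝ) : ℂ))
          (fun η => ((∑ j, ‖(heat c η (clamp T s) • a η - E s η) j‖ : ℝ) : ℂ)) ξ‖ₑ) ^ 2 ≤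
      16 * (ENNReal.ofReal (4 * π) * (Fintype.card (Fin 3) : ℝ≥0∞) ^ 2) ^ 2 *
        ((SNormLESNormFDerivOfEqConst ℂ (volume : Measure (EuclideanSpace ℝ (Fin 3))) 2 *
          ENNReal.ofReal (2 * π)) ^ (3 / 2 : ℝ)) ^ 2 *
        (Bb ^ (1 / 2 : ℝ) * Ab * (ENNReal.ofReal T * Eb) ^ (1 / 2 : ℝ)) := by
  set v : ℝ → EuclideanSpace ℝ (Fin 3) → Fin 3 → ℂ := fun s η => heat c η (clamp T s) • a η - E s η with hv
  set m₀ := Module.finrank ℝ (EuclideanSpace ℝ (Fin 3)) + 1 with hm₀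
  have hm₀lt : Module.finrank ℝ (EuclideanSpace ℝ (Fin 3)) < 2 * m₀ := finrank_lt_two_mul_succ
  have ha2 : ∀ j, ∫⁻ η, ‖a η j‖ₑ ^ 2 < ⊤ := fun j => by simpa using haw 0 j
  obtain ⟨B₀, hB₀⟩ := hEd m₀
  have hvm : ∀ s, AEStronglyMeasurable (v s) volume := aestronglyMeasurable_hsub_slice' c T a E ha hEm
  have hvj : AEStronglyMeasurable (uncurry v) (volume.prod volume) :=
    aestronglyMeasurable_uncurry_hsub' c T a E ha hEm
  have hv2 : ∀ s j, MemLp (v s · j) 2 volume := memLp_hsub_apply' c T a E hc.le ha ha2 hEm hm₀lt hB₀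
  have hvc : ∀ j s₀, Tendsto (fun s => eLpNorm ((v s · j) - (v s₀ · j)) 2 volume) (𝓝 s₀) (𝓝 0) :=
    tendsto_eLpNorm_hsub_apply' c T a E hc.le ha ha2 hEm hEt hm₀lt hB₀
  have hvw : ∀ s (k : ℕ) j, ∫⁻ η, (ENNReal.ofReal ((1 + ‖η‖) ^ k) * ‖v s η j‖ₑ) ^ 2 < ⊤ :=
    fun s k j => lintegral_weight_hsub_apply_sq_lt_top hc.le ha haw hEd s k j
  have hsqe : ∀ Θ : EuclideanSpace ℝ (Fin 3) → ℝ≥0∞, eLpNorm Θ 2 volume ^ 2 = ∫⁻ η, Θ η ^ 2 := by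
    intro Θ; rw [← lintegral_enorm_sq_eq_eLpNorm_sq]; simp only [enorm_eq_self]
  have hA' : ∀ s ∈ Icc 0 T, eLpNorm (fun η : EuclideanSpace ℝ (Fin 3) =>
      ENNReal.ofReal ‖η‖ * ∑ j, ‖v s η j‖ₑ) 2 volume ^ 2 ≤ Ab := fun s hs => by
    rw [hsqe]; exact hA s hs
  have hB' : ∀ s ∈ Icc 0 T, eLpNorm (fun η : EuclideanSpace ℝ (Fin 3) =>
      ENNReal.ofReal (‖η‖ ^ 2) * ∑ j, ‖v s η j‖ₑ) 2 volume ^ 2 ≤ Bb := fun s hs => by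
    rw [hsqe]; exact hB s hs
  have hE' : ∫⁻ s in Ioc 0 T, eLpNorm (fun η : EuclideanSpace ℝ (Fin 3) =>
      ENNReal.ofReal (‖η‖ ^ 3) * ∑ j, ‖v s η j‖ₑ) 2 volume ^ 2 ≤ Eb := by
    refine le_trans (le_of_eq (lintegral_congr fun s => hsqe _)) hE
  have h := lintegral_fourth_weight_Phi_le hvm hvm hvj hvj hv2 hv2 hvc hvc hvw hvw hA' hA' hB' hB' hE' hE'
  refine h.trans (le_of_eq ?_)
  ring

/-- **Level-two bilinear quantity of `v = h - E`.** If moreover `∫⁻(‖η‖² M_v(s))² ≤ Bb` on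
`[0, T]` and `∫₀ᵀ∫⁻(‖η‖³ M_v(s))² ≤ Eb`, then
`I₂ = ∫ ‖ξ‖⁴ ∫⁻_{(0,T]} φ_ξ² ≤ 16 C_N² K₃² Bb^{1/2} Ab (T Eb)^{1/2}` (`lintegral_fourth_weight_Phi_le`
with `p = q = v`). [cite: Tao2011, Lemma 2.1 (arXiv Lemma 23)] -/
theorem lintegral_fourth_weight_Phi_hsub_le (hc : 0 < c) (ha : AEStronglyMeasurable a volume)
    (haw : ∀ (k : ℕ) j, ∫⁻ η, (ENNReal.ofReal ((1 + ‖η‖) ^ k) * ‖a η j‖ₑ) ^ 2 < ⊤)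
    (hEc : Continuous (uncurry E)) (hEd : ∀ K : ℕ, ∃ B : ℝ, ∀ t, HasDecay K B (E t))
    {Ab Bb Eb : ℝ≥0∞}
    (hA : ∀ s ∈ Icc 0 T, ∫⁻ η, (ENNReal.ofReal ‖η‖ *
      ∑ j, ‖(heat c η (clamp T s) • a η - E s η) j‖ₑ) ^ 2 ≤ Ab)
    (hB : ∀ s ∈ Icc 0 T, ∫⁻ η, (ENNReal.ofReal (‖η‖ ^ 2) *
      ∑ j, ‖(heat c η (clamp T s) • a η - E s η) j‖ₑ) ^ 2 ≤ Bb)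
    (hE : ∫⁻ s in Ioc 0 T, ∫⁻ η, (ENNReal.ofReal (‖η‖ ^ 3) *
      ∑ j, ‖(heat c η (clamp T s) • a η - E s η) j‖ₑ) ^ 2 ≤ Eb) :
    ∫⁻ ξ, ENNReal.ofReal (‖ξ‖ ^ 4) * ∫⁻ s in Ioc 0 T, (ENNReal.ofReal (4 * π) *
        (Fintype.card (Fin 3) : ℝ≥0∞) ^ 2 *
        ‖fconv (fun η => ((∑ j, ‖(heat c η (clamp T s) • a η - E s η) j‖ : ℝ) : ℂ))
          (fun η => ((∑ j, ‖(heat c η (clamp T s) • a η - E s η) j‖ : ℝ) : ℂ)) ξ‖ₑ) ^ 2 ≤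
      16 * (ENNReal.ofReal (4 * π) * (Fintype.card (Fin 3) : ℝ≥0∞) ^ 2) ^ 2 *
        ((SNormLESNormFDerivOfEqConst ℂ (volume : Measure (EuclideanSpace ℝ (Fin 3))) 2 *
          ENNReal.ofReal (2 * π)) ^ (3 / 2 : ℝ)) ^ 2 *
        (Bb ^ (1 / 2 : ℝ) * Ab * (ENNReal.ofReal T * Eb) ^ (1 / 2 : ℝ)) :=
  lintegral_fourth_weight_Phi_hsub_le' hc ha haw hEc.measurable (fun η => hEc.uncurry_right η) hEd hA hB hE


/-! ### The heat part, time integrated (base of the induction) -/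

/-- **`L²ₜ` gain of the free evolution.** For `c > 0`, `T ≥ 0` and every `k`,
`∫⁻_{(0,T]} ∫⁻ (‖η‖^{k+2} ∑ⱼ‖(heat • a)(s)ⱼ‖ₑ)² ≤ (2c)⁻¹ ∫⁻ (‖η‖^{k+1} ∑ⱼ‖aⱼ‖ₑ)²`
(Tonelli and `‖η‖² ∫₀ᵀ heat² ≤ (2c)⁻¹`): the energy identity `∫₀ᵀ‖∇e^{tΔ}u₀‖²_{Ḣᵏ} ≤ ½‖u₀‖²_{Ḣᵏ}`
on the Fourier side. [cite: Tao2011, Lemma 2.1 (arXiv Lemma 23), (energy-duh2)] -/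
theorem lintegral_time_weight_majorant_heat_sq_le (hc : 0 < c) (hT : 0 ≤ T)
    (ha : AEStronglyMeasurable a volume) (k : ℕ) :
    ∫⁻ s in Ioc 0 T, ∫⁻ η, (ENNReal.ofReal (‖η‖ ^ (k + 2)) *
        ∑ j, ‖(heat c η (clamp T s) • a η) j‖ₑ) ^ 2 ≤
      ENNReal.ofReal (1 / (2 * c)) * ∫⁻ η, (ENNReal.ofReal (‖η‖ ^ (k + 1)) * ∑ j, ‖a η j‖ₑ) ^ 2 := by
  set A : EuclideanSpace ℝ (Fin 3) → ℝ≥0∞ := fun η => ∑ j, ‖a η j‖ₑ with hA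
  have hmaj : ∀ s η, (∑ j, ‖(heat c η (clamp T s) • a η) j‖ₑ) =
      ENNReal.ofReal (heat c η (clamp T s)) * A η := by
    intro s η
    rw [hA, Finset.mul_sum]
    refine Finset.sum_congr rfl fun j _ => ?_
    rw [heat_smul_apply, enorm_mul, ← ofReal_norm, Complex.norm_real,
      Real.norm_of_nonneg (heat_nonneg c η _)]
  set F : ℝ → EuclideanSpace ℝ (Fin 3) → ℝ≥0∞ := fun s η =>
    (ENNReal.ofReal (‖η‖ ^ (k + 2)) * ∑ j, ‖(heat c η (clamp T s) • a η) j‖ₑ) ^ 2 with hF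
  have hFm : AEMeasurable (uncurry F) ((volume.restrict (Ioc 0 T)).prod volume) := by
    have hj : AEStronglyMeasurable (fun z : ℝ × EuclideanSpace ℝ (Fin 3) =>
        heat c z.2 (clamp T z.1) • a z.2) (volume.prod volume) :=
      (continuous_heat_comp c continuous_snd ((continuous_clamp T).comp
        continuous_fst)).aestronglyMeasurable.smul
        (ha.comp_quasiMeasurePreserving Measure.quasiMeasurePreserving_snd)
    have h1 : AEMeasurable (uncurry F) (volume.prod volume) := by
      refine (((ENNReal.continuous_ofReal.comp (continuous_norm.pow (k + 2))).measurable.comp_aemeasurable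
        measurable_snd.aemeasurable).mul ?_).pow_const 2
      exact Finset.aemeasurable_fun_sum _ fun j _ =>
        ((continuous_apply j).comp_aestronglyMeasurable hj).enorm
    exact h1.mono_ac (Measure.AbsolutelyContinuous.prod Measure.restrict_le_self.absolutelyContinuous
      Measure.AbsolutelyContinuous.rfl)
  change ∫⁻ s in Ioc 0 T, ∫⁻ η, F s η ≤ _
  rw [lintegral_lintegral_swap hFm]
  have hheat : ∀ η, ∫⁻ s in Ioc 0 T, F s η ≤
      ENNReal.ofReal (1 / (2 * c)) * (ENNReal.ofReal (‖η‖ ^ (k + 1)) * A η) ^ 2 := by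
    intro η
    calc ∫⁻ s in Ioc 0 T, F s η
        = ∫⁻ s in Ioc 0 T, (ENNReal.ofReal (‖η‖ ^ (2 * k + 2 + 2)) * A η ^ 2) *
            ENNReal.ofReal (heat c η s ^ 2) := by
          refine setLIntegral_congr_fun measurableSet_Ioc fun s hs => ?_
          simp only [hF]
          rw [hmaj, clamp_of_mem ⟨hs.1.le, hs.2⟩, mul_pow, mul_pow, ← ENNReal.ofReal_pow (by positivity),
            ← ENNReal.ofReal_pow (heat_nonneg c η s), ← pow_mul]
          ring_nf
      _ = (ENNReal.ofReal (‖η‖ ^ (2 * k + 2 + 2)) * A η ^ 2) *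
            ∫⁻ s in Ioc 0 T, ENNReal.ofReal (heat c η s ^ 2) := by
          rw [lintegral_const_mul'' (f := fun s => ENNReal.ofReal (heat c η s ^ 2)) _
            ((ENNReal.continuous_ofReal.comp (by unfold heat; fun_prop)).measurable.aemeasurable)]
      _ = A η ^ 2 * (ENNReal.ofReal (‖η‖ ^ (2 * (k + 1) + 2)) *
            ∫⁻ s in Ioc 0 T, ENNReal.ofReal (heat c η s ^ 2)) := by ring_nf
      _ ≤ A η ^ 2 * (ENNReal.ofReal (1 / (2 * c)) * ENNReal.ofReal (‖η‖ ^ (2 * (k + 1)))) :=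
          mul_le_mul' le_rfl (norm_pow_mul_lintegral_heat_sq_le hc hT (k + 1) η)
      _ = ENNReal.ofReal (1 / (2 * c)) * (ENNReal.ofReal (‖η‖ ^ (k + 1)) * A η) ^ 2 := by
          rw [mul_pow, ← ENNReal.ofReal_pow (by positivity), ← pow_mul, mul_comm (k + 1) 2]; ring
  calc ∫⁻ η, ∫⁻ s in Ioc 0 T, F s η
      ≤ ∫⁻ η, ENNReal.ofReal (1 / (2 * c)) * (ENNReal.ofReal (‖η‖ ^ (k + 1)) * A η) ^ 2 :=
        lintegral_mono hheat
    _ = _ := lintegral_const_mul' _ _ ENNReal.ofReal_ne_top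

/-- **Sup bound of the free evolution**: `∫⁻ (W ∑ⱼ‖(heat • a)(s)ⱼ‖ₑ)² ≤ ∫⁻ (W ∑ⱼ‖aⱼ‖ₑ)²`
(`|heat| ≤ 1`, `c ≥ 0`). [folklore] -/
theorem lintegral_weight_majorant_heat_sq_le (hc : 0 ≤ c) (W : EuclideanSpace ℝ (Fin 3) → ℝ≥0∞)
    (s : ℝ) :
    ∫⁻ η, (W η * ∑ j, ‖(heat c η (clamp T s) • a η) j‖ₑ) ^ 2 ≤ ∫⁻ η, (W η * ∑ j, ‖a η j‖ₑ) ^ 2 := by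
  refine lintegral_mono fun η => ?_
  gcongr with j _
  exact enorm_heat_smul_apply_le hc s η j

/-! ### The induction step -/

/-- **The induction step of Tao's `X¹`/`X²` contraction bounds (Fourier side).** Let `c > 0`,
`T ≥ 0`, `a` a measurable datum with all weighted square moments finite, `E` of the class and
`v = h - E`. Write `α₁ = ∫⁻(‖η‖∑ⱼ‖aⱼ‖ₑ)²`, `α₂ = ∫⁻(‖η‖²∑ⱼ‖aⱼ‖ₑ)²`, `M_v(s) = ∑ⱼ‖v(s)ⱼ‖ₑ`, and
assume the smallness condition `2304 C_N² K₃² c⁻¹ (2T/c)^{1/2} α₁ ≤ 1` together with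

  `sup_{[0,T]} ∫⁻(‖η‖M_v)² ≤ 4α₁`, `∫₀ᵀ∫⁻(‖η‖²M_v)² ≤ (2/c)α₁`,
  `sup_{[0,T]} ∫⁻(‖η‖²M_v)² ≤ 4α₂`, `∫₀ᵀ∫⁻(‖η‖³M_v)² ≤ (2/c)α₂`.

Then the next iterate `v' = h - duhamelIntegral c T v` obeys the same four bounds: by
`I₁ ≤ 32C_N²K₃²(2T/c)^{1/2}α₁²`, `I₂ ≤ 128C_N²K₃²(2T/c)^{1/2}α₁α₂` and the transfer bounds
(`2α + 18(2c)⁻¹I` in sup, `c⁻¹α + 18c⁻²I` in `L²ₜ`). This is the ball-preservation half of the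
contraction argument in the proof of Thm. 5.1 (arXiv Thm. 28, p. 16), with the `X²` level carried
linearly. [cite: Tao2011, Thm. 5.1 / Lemma 2.1 (arXiv Thm. 28, Lemma 23)]
Twin for the wide (jointly measurable, time-continuous at each frequency) class of `E`. -/
theorem picard_step_bounds' (hc : 0 < c) (hT : 0 ≤ T) (ha : AEStronglyMeasurable a volume)
    (haw : ∀ (k : ℕ) j, ∫⁻ η, (ENNReal.ofReal ((1 + ‖η‖) ^ k) * ‖a η j‖ₑ) ^ 2 < ⊤)
    (hEm : Measurable (uncurry E)) (hEt : ∀ η, Continuous fun s => E s η)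
    (hEd : ∀ K : ℕ, ∃ B : ℝ, ∀ t, HasDecay K B (E t))
    (hs : 2304 * (ENNReal.ofReal (4 * π) * (Fintype.card (Fin 3) : ℝ≥0∞) ^ 2) ^ 2 *
        ((SNormLESNormFDerivOfEqConst ℂ (volume : Measure (EuclideanSpace ℝ (Fin 3))) 2 *
          ENNReal.ofReal (2 * π)) ^ (3 / 2 : ℝ)) ^ 2 * ENNReal.ofReal c⁻¹ *
        (ENNReal.ofReal T * ENNReal.ofReal (2 / c)) ^ (1 / 2 : ℝ) *
        (∫⁻ η, (ENNReal.ofReal ‖η‖ * ∑ j, ‖a η j‖ₑ) ^ 2) ≤ 1)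
    (hA : ∀ s ∈ Icc 0 T, ∫⁻ η, (ENNReal.ofReal ‖η‖ *
      ∑ j, ‖(heat c η (clamp T s) • a η - E s η) j‖ₑ) ^ 2 ≤
        4 * ∫⁻ η, (ENNReal.ofReal ‖η‖ * ∑ j, ‖a η j‖ₑ) ^ 2)
    (hP : ∫⁻ s in Ioc 0 T, ∫⁻ η, (ENNReal.ofReal (‖η‖ ^ 2) *
      ∑ j, ‖(heat c η (clamp T s) • a η - E s η) j‖ₑ) ^ 2 ≤
        ENNReal.ofReal (2 / c) * ∫⁻ η, (ENNReal.ofReal ‖η‖ * ∑ j, ‖a η j‖ₑ) ^ 2)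
    (hB : ∀ s ∈ Icc 0 T, ∫⁻ η, (ENNReal.ofReal (‖η‖ ^ 2) *
      ∑ j, ‖(heat c η (clamp T s) • a η - E s η) j‖ₑ) ^ 2 ≤
        4 * ∫⁻ η, (ENNReal.ofReal (‖η‖ ^ 2) * ∑ j, ‖a η j‖ₑ) ^ 2)
    (hE : ∫⁻ s in Ioc 0 T, ∫⁻ η, (ENNReal.ofReal (‖η‖ ^ 3) *
      ∑ j, ‖(heat c η (clamp T s) • a η - E s η) j‖ₑ) ^ 2 ≤
        ENNReal.ofReal (2 / c) * ∫⁻ η, (ENNReal.ofReal (‖η‖ ^ 2) * ∑ j, ‖a η j‖ₑ) ^ 2) :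
    (∀ t ∈ Icc 0 T, ∫⁻ η, (ENNReal.ofReal ‖η‖ * ∑ j, ‖(heat c η (clamp T t) • a η -
        duhamelIntegral c T (fun s ζ => heat c ζ (clamp T s) • a ζ - E s ζ) t η) j‖ₑ) ^ 2 ≤
        4 * ∫⁻ η, (ENNReal.ofReal ‖η‖ * ∑ j, ‖a η j‖ₑ) ^ 2) ∧
    (∫⁻ t in Ioc 0 T, ∫⁻ η, (ENNReal.ofReal (‖η‖ ^ 2) * ∑ j, ‖(heat c η (clamp T t) • a η -
        duhamelIntegral c T (fun s ζ => heat c ζ (clamp T s) • a ζ - E s ζ) t η) j‖ₑ) ^ 2 ≤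
        ENNReal.ofReal (2 / c) * ∫⁻ η, (ENNReal.ofReal ‖η‖ * ∑ j, ‖a η j‖ₑ) ^ 2) ∧
    (∀ t ∈ Icc 0 T, ∫⁻ η, (ENNReal.ofReal (‖η‖ ^ 2) * ∑ j, ‖(heat c η (clamp T t) • a η -
        duhamelIntegral c T (fun s ζ => heat c ζ (clamp T s) • a ζ - E s ζ) t η) j‖ₑ) ^ 2 ≤
        4 * ∫⁻ η, (ENNReal.ofReal (‖η‖ ^ 2) * ∑ j, ‖a η j‖ₑ) ^ 2) ∧
    (∫⁻ t in Ioc 0 T, ∫⁻ η, (ENNReal.ofReal (‖η‖ ^ 3) * ∑ j, ‖(heat c η (clamp T t) • a η -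
        duhamelIntegral c T (fun s ζ => heat c ζ (clamp T s) • a ζ - E s ζ) t η) j‖ₑ) ^ 2 ≤
        ENNReal.ofReal (2 / c) * ∫⁻ η, (ENNReal.ofReal (‖η‖ ^ 2) * ∑ j, ‖a η j‖ₑ) ^ 2) := by
  -- the bilinear quantities of `v`
  have hI₁ := lintegral_sq_weight_Phi_hsub_le' hc ha haw hEm hEt hEd hA hP
  have hI₂ := lintegral_fourth_weight_Phi_hsub_le' hc ha haw hEm hEt hEd hA hB hE
  -- the four transfer bounds (raw form)
  have hTA := fun t (ht : t ∈ Icc 0 T) => sup_weight_majorant_next_sq_le' (T := T) hc ha haw hEm hEt hEd 1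
    ((lintegral_congr fun ξ => by norm_num).trans_le hI₁) ht
  have hTP := lintegral_time_weight_majorant_next_sq_le' hc hT ha haw hEm hEt hEd 0
    ((lintegral_congr fun ξ => by norm_num).trans_le hI₁)
  have hTB := fun t (ht : t ∈ Icc 0 T) => sup_weight_majorant_next_sq_le' (T := T) hc ha haw hEm hEt hEd 2
    ((lintegral_congr fun ξ => by norm_num).trans_le hI₂) ht
  have hTE := lintegral_time_weight_majorant_next_sq_le' hc hT ha haw hEm hEt hEd 1
    ((lintegral_congr fun ξ => by norm_num).trans_le hI₂)
  simp only [pow_one] at hTA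
  simp only [zero_add, pow_one] at hTP
  simp only [show (1 : ℕ) + 2 = 3 from rfl, show (1 : ℕ) + 1 = 2 from rfl] at hTE
  -- abbreviations
  set C : ℝ≥0∞ := ENNReal.ofReal (4 * π) * (Fintype.card (Fin 3) : ℝ≥0∞) ^ 2 with hC
  set K3 : ℝ≥0∞ := (SNormLESNormFDerivOfEqConst ℂ (volume : Measure (EuclideanSpace ℝ (Fin 3))) 2 *
    ENNReal.ofReal (2 * π)) ^ (3 / 2 : ℝ) with hK3
  set α₁ : ℝ≥0∞ := ∫⁻ η, (ENNReal.ofReal ‖η‖ * ∑ j, ‖a η j‖ₑ) ^ 2 with hα₁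
  set α₂ : ℝ≥0∞ := ∫⁻ η, (ENNReal.ofReal (‖η‖ ^ 2) * ∑ j, ‖a η j‖ₑ) ^ 2 with hα₂
  set θ : ℝ≥0∞ := (ENNReal.ofReal T * ENNReal.ofReal (2 / c)) ^ (1 / 2 : ℝ) with hθ
  set κ : ℝ≥0∞ := C ^ 2 * K3 ^ 2 * ENNReal.ofReal c⁻¹ * θ * α₁ with hκ
  have hs' : 2304 * κ ≤ 1 := by
    calc 2304 * κ = 2304 * C ^ 2 * K3 ^ 2 * ENNReal.ofReal c⁻¹ * θ * α₁ := by rw [hκ]; ring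
      _ ≤ 1 := hs
  -- numeric identities
  have hTP' : ∀ x : ℝ≥0∞, (ENNReal.ofReal T * (ENNReal.ofReal (2 / c) * x)) ^ (1 / 2 : ℝ) =
      θ * x ^ (1 / 2 : ℝ) := fun x => by
    rw [← mul_assoc, ENNReal.mul_rpow_of_nonneg _ _ (by norm_num)]
  have hI₁' : (4 * α₁) ^ (1 / 2 : ℝ) * (4 * α₁) *
      (ENNReal.ofReal T * (ENNReal.ofReal (2 / c) * α₁)) ^ (1 / 2 : ℝ) = 8 * θ * α₁ ^ 2 := by
    rw [four_mul_rpow_half, hTP']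
    calc 2 * α₁ ^ (1 / 2 : ℝ) * (4 * α₁) * (θ * α₁ ^ (1 / 2 : ℝ))
        = 8 * θ * α₁ * (α₁ ^ (1 / 2 : ℝ) * α₁ ^ (1 / 2 : ℝ)) := by ring
      _ = 8 * θ * α₁ ^ 2 := by rw [rpow_half_mul_rpow_half]; ring
  have hI₂' : (4 * α₂) ^ (1 / 2 : ℝ) * (4 * α₁) *
      (ENNReal.ofReal T * (ENNReal.ofReal (2 / c) * α₂)) ^ (1 / 2 : ℝ) = 8 * θ * α₁ * α₂ := by
    rw [four_mul_rpow_half, hTP']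
    calc 2 * α₂ ^ (1 / 2 : ℝ) * (4 * α₁) * (θ * α₂ ^ (1 / 2 : ℝ))
        = 8 * θ * α₁ * (α₂ ^ (1 / 2 : ℝ) * α₂ ^ (1 / 2 : ℝ)) := by ring
      _ = 8 * θ * α₁ * α₂ := by rw [rpow_half_mul_rpow_half]
  have hcinv : ENNReal.ofReal (1 / (2 * c)) ≤ ENNReal.ofReal c⁻¹ :=
    ENNReal.ofReal_le_ofReal (by rw [one_div]; exact inv_anti₀ hc (by linarith))
  have hc2 : ENNReal.ofReal (c⁻¹ ^ 2) = ENNReal.ofReal c⁻¹ * ENNReal.ofReal c⁻¹ := by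
    rw [sq, ENNReal.ofReal_mul (inv_nonneg.2 hc.le)]
  have h2c : ENNReal.ofReal (2 / c) = 2 * ENNReal.ofReal c⁻¹ := by
    rw [div_eq_mul_inv, ENNReal.ofReal_mul (by norm_num), ENNReal.ofReal_ofNat]
  have h1c : ENNReal.ofReal (1 / c) = ENNReal.ofReal c⁻¹ := by rw [one_div]
  -- the key smallness consequences
  have hX₁ : 18 * ENNReal.ofReal (1 / (2 * c)) * (4 * C ^ 2 * K3 ^ 2 * (8 * θ * α₁ ^ 2)) ≤ α₁ :=
    calc 18 * ENNReal.ofReal (1 / (2 * c)) * (4 * C ^ 2 * K3 ^ 2 * (8 * θ * α₁ ^ 2))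
        ≤ 18 * ENNReal.ofReal c⁻¹ * (4 * C ^ 2 * K3 ^ 2 * (8 * θ * α₁ ^ 2)) :=
          mul_le_mul' (mul_le_mul' le_rfl hcinv) le_rfl
      _ = 576 * κ * α₁ := by rw [hκ]; ring
      _ ≤ 2304 * κ * α₁ := mul_le_mul' (mul_le_mul' (by norm_num) le_rfl) le_rfl
      _ ≤ 1 * α₁ := mul_le_mul' hs' le_rfl
      _ = α₁ := one_mul _
  have hY₁ : 18 * ENNReal.ofReal (c⁻¹ ^ 2) * (4 * C ^ 2 * K3 ^ 2 * (8 * θ * α₁ ^ 2)) ≤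
      ENNReal.ofReal c⁻¹ * α₁ :=
    calc 18 * ENNReal.ofReal (c⁻¹ ^ 2) * (4 * C ^ 2 * K3 ^ 2 * (8 * θ * α₁ ^ 2))
        = ENNReal.ofReal c⁻¹ * (576 * κ * α₁) := by rw [hc2, hκ]; ring
      _ ≤ ENNReal.ofReal c⁻¹ * (2304 * κ * α₁) :=
          mul_le_mul' le_rfl (mul_le_mul' (mul_le_mul' (by norm_num) le_rfl) le_rfl)
      _ ≤ ENNReal.ofReal c⁻¹ * (1 * α₁) := mul_le_mul' le_rfl (mul_le_mul' hs' le_rfl)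
      _ = ENNReal.ofReal c⁻¹ * α₁ := by rw [one_mul]
  have hX₂ : 18 * ENNReal.ofReal (1 / (2 * c)) * (16 * C ^ 2 * K3 ^ 2 * (8 * θ * α₁ * α₂)) ≤ α₂ :=
    calc 18 * ENNReal.ofReal (1 / (2 * c)) * (16 * C ^ 2 * K3 ^ 2 * (8 * θ * α₁ * α₂))
        ≤ 18 * ENNReal.ofReal c⁻¹ * (16 * C ^ 2 * K3 ^ 2 * (8 * θ * α₁ * α₂)) :=
          mul_le_mul' (mul_le_mul' le_rfl hcinv) le_rfl
      _ = 2304 * κ * α₂ := by rw [hκ]; ring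
      _ ≤ 1 * α₂ := mul_le_mul' hs' le_rfl
      _ = α₂ := one_mul _
  have hY₂ : 18 * ENNReal.ofReal (c⁻¹ ^ 2) * (16 * C ^ 2 * K3 ^ 2 * (8 * θ * α₁ * α₂)) ≤
      ENNReal.ofReal c⁻¹ * α₂ :=
    calc 18 * ENNReal.ofReal (c⁻¹ ^ 2) * (16 * C ^ 2 * K3 ^ 2 * (8 * θ * α₁ * α₂))
        = ENNReal.ofReal c⁻¹ * (2304 * κ * α₂) := by rw [hc2, hκ]; ring
      _ ≤ ENNReal.ofReal c⁻¹ * (1 * α₂) := mul_le_mul' le_rfl (mul_le_mul' hs' le_rfl)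
      _ = ENNReal.ofReal c⁻¹ * α₂ := by rw [one_mul]
  refine ⟨fun t ht => ?_, ?_, fun t ht => ?_, ?_⟩
  · calc _ ≤ _ := hTA t ht
      _ = 2 * α₁ + 18 * ENNReal.ofReal (1 / (2 * c)) * (4 * C ^ 2 * K3 ^ 2 * (8 * θ * α₁ ^ 2)) := by
          rw [hI₁']
      _ ≤ 2 * α₁ + α₁ := add_le_add le_rfl hX₁
      _ = 3 * α₁ := by ring
      _ ≤ 4 * α₁ := mul_le_mul' (by norm_num) le_rfl
  · calc _ ≤ _ := hTP
      _ = ENNReal.ofReal c⁻¹ * α₁ +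
          18 * ENNReal.ofReal (c⁻¹ ^ 2) * (4 * C ^ 2 * K3 ^ 2 * (8 * θ * α₁ ^ 2)) := by
          rw [hI₁', h1c]
      _ ≤ ENNReal.ofReal c⁻¹ * α₁ + ENNReal.ofReal c⁻¹ * α₁ := add_le_add le_rfl hY₁
      _ = ENNReal.ofReal (2 / c) * α₁ := by rw [h2c]; ring
  · calc _ ≤ _ := hTB t ht
      _ = 2 * α₂ + 18 * ENNReal.ofReal (1 / (2 * c)) * (16 * C ^ 2 * K3 ^ 2 * (8 * θ * α₁ * α₂)) := by
          rw [hI₂']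
      _ ≤ 2 * α₂ + α₂ := add_le_add le_rfl hX₂
      _ = 3 * α₂ := by ring
      _ ≤ 4 * α₂ := mul_le_mul' (by norm_num) le_rfl
  · calc _ ≤ _ := hTE
      _ = ENNReal.ofReal c⁻¹ * α₂ +
          18 * ENNReal.ofReal (c⁻¹ ^ 2) * (16 * C ^ 2 * K3 ^ 2 * (8 * θ * α₁ * α₂)) := by
          rw [hI₂', h1c]
      _ ≤ ENNReal.ofReal c⁻¹ * α₂ + ENNReal.ofReal c⁻¹ * α₂ := add_le_add le_rfl hY₂
      _ = ENNReal.ofReal (2 / c) * α₂ := by rw [h2c]; ring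

/-- **The induction step of Tao's `X¹`/`X²` contraction bounds (Fourier side).** Let `c > 0`,
`T ≥ 0`, `a` a measurable datum with all weighted square moments finite, `E` of the class and
`v = h - E`. Write `α₁ = ∫⁻(‖η‖∑ⱼ‖aⱼ‖ₑ)²`, `α₂ = ∫⁻(‖η‖²∑ⱼ‖aⱼ‖ₑ)²`, `M_v(s) = ∑ⱼ‖v(s)ⱼ‖ₑ`, and
assume the smallness condition `2304 C_N² K₃² c⁻¹ (2T/c)^{1/2} α₁ ≤ 1` together with

  `sup_{[0,T]} ∫⁻(‖η‖M_v)² ≤ 4α₁`, `∫₀ᵀ∫⁻(‖η‖²M_v)² ≤ (2/c)α₁`,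
  `sup_{[0,T]} ∫⁻(‖η‖²M_v)² ≤ 4α₂`, `∫₀ᵀ∫⁻(‖η‖³M_v)² ≤ (2/c)α₂`.

Then the next iterate `v' = h - duhamelIntegral c T v` obeys the same four bounds: by
`I₁ ≤ 32C_N²K₃²(2T/c)^{1/2}α₁²`, `I₂ ≤ 128C_N²K₃²(2T/c)^{1/2}α₁α₂` and the transfer bounds
(`2α + 18(2c)⁻¹I` in sup, `c⁻¹α + 18c⁻²I` in `L²ₜ`). This is the ball-preservation half of the
contraction argument in the proof of Thm. 5.1 (arXiv Thm. 28, p. 16), with the `X²` level carried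
linearly. [cite: Tao2011, Thm. 5.1 / Lemma 2.1 (arXiv Thm. 28, Lemma 23)] -/
theorem picard_step_bounds (hc : 0 < c) (hT : 0 ≤ T) (ha : AEStronglyMeasurable a volume)
    (haw : ∀ (k : ℕ) j, ∫⁻ η, (ENNReal.ofReal ((1 + ‖η‖) ^ k) * ‖a η j‖ₑ) ^ 2 < ⊤)
    (hEc : Continuous (uncurry E)) (hEd : ∀ K : ℕ, ∃ B : ℝ, ∀ t, HasDecay K B (E t))
    (hs : 2304 * (ENNReal.ofReal (4 * π) * (Fintype.card (Fin 3) : ℝ≥0∞) ^ 2) ^ 2 *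
        ((SNormLESNormFDerivOfEqConst ℂ (volume : Measure (EuclideanSpace ℝ (Fin 3))) 2 *
          ENNReal.ofReal (2 * π)) ^ (3 / 2 : ℝ)) ^ 2 * ENNReal.ofReal c⁻¹ *
        (ENNReal.ofReal T * ENNReal.ofReal (2 / c)) ^ (1 / 2 : ℝ) *
        (∫⁻ η, (ENNReal.ofReal ‖η‖ * ∑ j, ‖a η j‖ₑ) ^ 2) ≤ 1)
    (hA : ∀ s ∈ Icc 0 T, ∫⁻ η, (ENNReal.ofReal ‖η‖ *
      ∑ j, ‖(heat c η (clamp T s) • a η - E s η) j‖ₑ) ^ 2 ≤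
        4 * ∫⁻ η, (ENNReal.ofReal ‖η‖ * ∑ j, ‖a η j‖ₑ) ^ 2)
    (hP : ∫⁻ s in Ioc 0 T, ∫⁻ η, (ENNReal.ofReal (‖η‖ ^ 2) *
      ∑ j, ‖(heat c η (clamp T s) • a η - E s η) j‖ₑ) ^ 2 ≤
        ENNReal.ofReal (2 / c) * ∫⁻ η, (ENNReal.ofReal ‖η‖ * ∑ j, ‖a η j‖ₑ) ^ 2)
    (hB : ∀ s ∈ Icc 0 T, ∫⁻ η, (ENNReal.ofReal (‖η‖ ^ 2) *
      ∑ j, ‖(heat c η (clamp T s) • a η - E s η) j‖ₑ) ^ 2 ≤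
        4 * ∫⁻ η, (ENNReal.ofReal (‖η‖ ^ 2) * ∑ j, ‖a η j‖ₑ) ^ 2)
    (hE : ∫⁻ s in Ioc 0 T, ∫⁻ η, (ENNReal.ofReal (‖η‖ ^ 3) *
      ∑ j, ‖(heat c η (clamp T s) • a η - E s η) j‖ₑ) ^ 2 ≤
        ENNReal.ofReal (2 / c) * ∫⁻ η, (ENNReal.ofReal (‖η‖ ^ 2) * ∑ j, ‖a η j‖ₑ) ^ 2) :
    (∀ t ∈ Icc 0 T, ∫⁻ η, (ENNReal.ofReal ‖η‖ * ∑ j, ‖(heat c η (clamp T t) • a η -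
        duhamelIntegral c T (fun s ζ => heat c ζ (clamp T s) • a ζ - E s ζ) t η) j‖ₑ) ^ 2 ≤
        4 * ∫⁻ η, (ENNReal.ofReal ‖η‖ * ∑ j, ‖a η j‖ₑ) ^ 2) ∧
    (∫⁻ t in Ioc 0 T, ∫⁻ η, (ENNReal.ofReal (‖η‖ ^ 2) * ∑ j, ‖(heat c η (clamp T t) • a η -
        duhamelIntegral c T (fun s ζ => heat c ζ (clamp T s) • a ζ - E s ζ) t η) j‖ₑ) ^ 2 ≤
        ENNReal.ofReal (2 / c) * ∫⁻ η, (ENNReal.ofReal ‖η‖ * ∑ j, ‖a η j‖ₑ) ^ 2) ∧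
    (∀ t ∈ Icc 0 T, ∫⁻ η, (ENNReal.ofReal (‖η‖ ^ 2) * ∑ j, ‖(heat c η (clamp T t) • a η -
        duhamelIntegral c T (fun s ζ => heat c ζ (clamp T s) • a ζ - E s ζ) t η) j‖ₑ) ^ 2 ≤
        4 * ∫⁻ η, (ENNReal.ofReal (‖η‖ ^ 2) * ∑ j, ‖a η j‖ₑ) ^ 2) ∧
    (∫⁻ t in Ioc 0 T, ∫⁻ η, (ENNReal.ofReal (‖η‖ ^ 3) * ∑ j, ‖(heat c η (clamp T t) • a η -
        duhamelIntegral c T (fun s ζ => heat c ζ (clamp T s) • a ζ - E s ζ) t η) j‖ₑ) ^ 2 ≤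
        ENNReal.ofReal (2 / c) * ∫⁻ η, (ENNReal.ofReal (‖η‖ ^ 2) * ∑ j, ‖a η j‖ₑ) ^ 2) :=
  picard_step_bounds' hc hT ha haw hEc.measurable (fun η => hEc.uncurry_right η) hEd hs hA hP hB hE


/-! ### Uniform bounds for all Picard iterates -/

/-- **Tao 2013, proof of Thm. 5.1/5.4 (ii) — the Picard iterates stay in the ball (Fourier side,
levels 1 and 2).** Let `c > 0`, `T ≥ 0`, `a` a measurable datum with all weighted square moments
finite, `α₁ = ∫⁻(‖η‖∑ⱼ‖aⱼ‖ₑ)²`, `α₂ = ∫⁻(‖η‖²∑ⱼ‖aⱼ‖ₑ)²`, and assume the smallness condition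

  `2304 · C_N² K₃² · c⁻¹ (2T/c)^{1/2} · α₁ ≤ 1`   (`C_N = 4π · 9`, `K₃ = (K_{GNS} 2π)^{3/2}`),

i.e. `T α₁² ≤ c₀ c³` — Tao's `‖u₀‖⁴_{H¹} T ≤ c` after rescaling (only the homogeneous `Ḣ¹` size
enters). Then every Picard iterate `v_n = picardIter c T a n`, `M_n(s) = ∑ⱼ ‖v_n(s)ⱼ‖ₑ`, obeys

  `sup_{s∈[0,T]} ∫⁻(‖η‖M_n(s))² ≤ 4α₁`,  `∫₀ᵀ∫⁻(‖η‖²M_n(s))² ≤ (2/c)α₁`,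
  `sup_{s∈[0,T]} ∫⁻(‖η‖²M_n(s))² ≤ 4α₂`, `∫₀ᵀ∫⁻(‖η‖³M_n(s))² ≤ (2/c)α₂`

(`‖v_n‖_{X¹} ≲ ‖u₀‖_{Ḣ¹}`, `‖v_n‖_{X²} ≲ ‖u₀‖_{Ḣ²}` uniformly in `n`). [cite: Tao2011, Thm. 5.4 (ii)
(arXiv Thm. 31), proof of Thm. 5.1 (arXiv Thm. 28, p. 16)] -/
theorem picard_uniform_bounds (hc : 0 < c) (hT : 0 ≤ T) (ha : AEStronglyMeasurable a volume)
    (haw : ∀ (k : ℕ) j, ∫⁻ η, (ENNReal.ofReal ((1 + ‖η‖) ^ k) * ‖a η j‖ₑ) ^ 2 < ⊤)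
    (hs : 2304 * (ENNReal.ofReal (4 * π) * (Fintype.card (Fin 3) : ℝ≥0∞) ^ 2) ^ 2 *
        ((SNormLESNormFDerivOfEqConst ℂ (volume : Measure (EuclideanSpace ℝ (Fin 3))) 2 *
          ENNReal.ofReal (2 * π)) ^ (3 / 2 : ℝ)) ^ 2 * ENNReal.ofReal c⁻¹ *
        (ENNReal.ofReal T * ENNReal.ofReal (2 / c)) ^ (1 / 2 : ℝ) *
        (∫⁻ η, (ENNReal.ofReal ‖η‖ * ∑ j, ‖a η j‖ₑ) ^ 2) ≤ 1) (n : ℕ) :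
    (∀ t ∈ Icc 0 T, ∫⁻ η, (ENNReal.ofReal ‖η‖ * ∑ j, ‖picardIter c T a n t η j‖ₑ) ^ 2 ≤
        4 * ∫⁻ η, (ENNReal.ofReal ‖η‖ * ∑ j, ‖a η j‖ₑ) ^ 2) ∧
    (∫⁻ t in Ioc 0 T, ∫⁻ η, (ENNReal.ofReal (‖η‖ ^ 2) * ∑ j, ‖picardIter c T a n t η j‖ₑ) ^ 2 ≤
        ENNReal.ofReal (2 / c) * ∫⁻ η, (ENNReal.ofReal ‖η‖ * ∑ j, ‖a η j‖ₑ) ^ 2) ∧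
    (∀ t ∈ Icc 0 T, ∫⁻ η, (ENNReal.ofReal (‖η‖ ^ 2) * ∑ j, ‖picardIter c T a n t η j‖ₑ) ^ 2 ≤
        4 * ∫⁻ η, (ENNReal.ofReal (‖η‖ ^ 2) * ∑ j, ‖a η j‖ₑ) ^ 2) ∧
    (∫⁻ t in Ioc 0 T, ∫⁻ η, (ENNReal.ofReal (‖η‖ ^ 3) * ∑ j, ‖picardIter c T a n t η j‖ₑ) ^ 2 ≤
        ENNReal.ofReal (2 / c) * ∫⁻ η, (ENNReal.ofReal (‖η‖ ^ 2) * ∑ j, ‖a η j‖ₑ) ^ 2) := by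
  induction n with
  | zero =>
    have h0 : picardIter c T a 0 = fun t ξ => heat c ξ (clamp T t) • a ξ := rfl
    have h4 : ∀ x : ℝ≥0∞, x ≤ 4 * x := fun x =>
      calc x = 1 * x := (one_mul x).symm
        _ ≤ 4 * x := mul_le_mul' (by norm_num) le_rfl
    have hcc : ENNReal.ofReal (1 / (2 * c)) ≤ ENNReal.ofReal (2 / c) :=
      ENNReal.ofReal_le_ofReal (by
        rw [div_le_div_iff₀ (by positivity) hc]; nlinarith)
    simp only [h0]
    refine ⟨fun t _ => (lintegral_weight_majorant_heat_sq_le hc.le _ t).trans (h4 _), ?_,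
      fun t _ => (lintegral_weight_majorant_heat_sq_le hc.le _ t).trans (h4 _), ?_⟩
    · have h := lintegral_time_weight_majorant_heat_sq_le hc hT ha 0
      simp only [zero_add, pow_one] at h
      exact h.trans (mul_le_mul' hcc le_rfl)
    · have h := lintegral_time_weight_majorant_heat_sq_le hc hT ha 1
      exact h.trans (mul_le_mul' hcc le_rfl)
  | succ n ih =>
    set En : ℝ → EuclideanSpace ℝ (Fin 3) → Fin 3 → ℂ :=
      fun t ξ => heat c ξ (clamp T t) • a ξ - picardIter c T a n t ξ with hEn
    have hvn : (fun s η => heat c η (clamp T s) • a η - En s η) = picardIter c T a n := by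
      funext s η; simp [hEn]
    have hstep : picardIter c T a (n + 1) = fun t ξ => heat c ξ (clamp T t) • a ξ -
        duhamelIntegral c T (fun s η => heat c η (clamp T s) • a η - En s η) t ξ := by
      funext t ξ
      rw [hvn, picardIter, duhamel_eq]
    obtain ⟨hEc, hEd⟩ := class_picardIter hc.le hT ha haw n
    obtain ⟨hA, hP, hB, hE⟩ := ih
    have hA' : ∀ s ∈ Icc 0 T, ∫⁻ η, (ENNReal.ofReal ‖η‖ *
        ∑ j, ‖(heat c η (clamp T s) • a η - En s η) j‖ₑ) ^ 2 ≤
          4 * ∫⁻ η, (ENNReal.ofReal ‖η‖ * ∑ j, ‖a η j‖ₑ) ^ 2 := fun s hs => by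
      simpa only [hEn, sub_sub_cancel] using hA s hs
    have hP' : ∫⁻ s in Ioc 0 T, ∫⁻ η, (ENNReal.ofReal (‖η‖ ^ 2) *
        ∑ j, ‖(heat c η (clamp T s) • a η - En s η) j‖ₑ) ^ 2 ≤
          ENNReal.ofReal (2 / c) * ∫⁻ η, (ENNReal.ofReal ‖η‖ * ∑ j, ‖a η j‖ₑ) ^ 2 := by
      simpa only [hEn, sub_sub_cancel] using hP
    have hB' : ∀ s ∈ Icc 0 T, ∫⁻ η, (ENNReal.ofReal (‖η‖ ^ 2) *
        ∑ j, ‖(heat c η (clamp T s) • a η - En s η) j‖ₑ) ^ 2 ≤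
          4 * ∫⁻ η, (ENNReal.ofReal (‖η‖ ^ 2) * ∑ j, ‖a η j‖ₑ) ^ 2 := fun s hs => by
      simpa only [hEn, sub_sub_cancel] using hB s hs
    have hE' : ∫⁻ s in Ioc 0 T, ∫⁻ η, (ENNReal.ofReal (‖η‖ ^ 3) *
        ∑ j, ‖(heat c η (clamp T s) • a η - En s η) j‖ₑ) ^ 2 ≤
          ENNReal.ofReal (2 / c) * ∫⁻ η, (ENNReal.ofReal (‖η‖ ^ 2) * ∑ j, ‖a η j‖ₑ) ^ 2 := by
      simpa only [hEn, sub_sub_cancel] using hE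
    have h := picard_step_bounds hc hT ha haw hEc hEd hs hA' hP' hB' hE'
    rw [hstep]
    exact h

end Literature.Analysis.FluidPDE.FourierNS

end
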